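/-
Copyright: the b2b-balaban cell (near-miss cell 7), T⁴-continuum fan-out, lineage t4-ne7b-p2 (node U5c RENEWAL member).
Released under the licence of the surrounding project.
-/
import Literature.MathematicalPhysics.QuantumFieldTheory.Balaban1983to89.T4PersistenceGrove

/-!
# The combined-catalogue renewal constructor and its multiplicative (absolute-majorant) form

Summits-side support leaf of the T⁴-continuum cell (rung (B)+1 on a FINITE torus only; NOT infinite volume, NOT the
mass gap, NOT the Clay statement; NOT a proof of the spine estimate NE7b).  Lineage `t4-ne7b-p2` (generation 22),
node U5c, RENEWAL route; leaf N4a of the ROUND-2 skeleton `t4/skeletons/NE7b-t4-ne7b-p2.md`.  [folklore] finite sums and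
real arithmetic over the lineage's OWN carriers (`T4PersistenceRenewal.ForestWitness ∕ ForestDom`,
`T4PersistenceGrove.Grove ∕ Step ∕ Script ∕ horizon ∕ booking`); nothing is quoted from print, nothing printed is asserted,
no `[cite:]` tag; none of the cell's conditionals ((B), BetaPertH) occurs.

WHY.  `T4PersistenceGrove.forestDom_of_grove_raw` asks the one-event catalogue in SPLIT form — injective shapes in a
PARENT-FREE catalogue `Shapes s ℓ` with `Σ_{σ ∈ Shapes s ℓ} φ ≤ ε`.  On the renewal route in the (GD) absolute-majorant
currency the position count of the one-event extensions of a pending structure depends on the structure (it is cancelled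
by a prepaid size bank carried in the majorant), so the natural leaf is the COMBINED, PER-PARENT, PARENT-UNIFORM clause
`Σ_{children c of P at age s} pr c · z₁^(booking c) ≤ ε` — which is what `ForestWitness.child` consumes anyway.

WHAT.  §1 `forestDom_of_banked_sum`: `T4PersistenceRenewal.ForestDom.of_banked_pricing` with the split catalogue
((SH) `hinj`∕`hmem`, `hφ`, (PR-banked) `hprice`, (ENT) `hent`) replaced by ONE per-parent banked sum
`Σ_{children of P at age s} ω c·z₁^(E c)·z₁^(s − last P) ≤ ε·(ω P·z₁^(E P))`.  §2 `forestDom_of_grove_sum`: the LEDGER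
form — `forestDom_of_grove_raw` with the split catalogue replaced by
`hcat : Σ_{children of P at age s ≤ Ah} pr c·z₁^(booking c) ≤ ε` (raw prices `hraw`∕`hraw₀`, root pairing mass, ledger
`hroot`∕`hstep`∕`hpend` unchanged).  §3 `forestDom_of_grove_product` ∕ `sum_le_of_grove_product`: the ABSOLUTE-MAJORANT
specialisation — when the weight IS a product along the record (`ω root = pr root`, `ω c = pr c·ω (parent c)`), the two
raw relative prices hold by `le_of_eq`, the reference weight is `1`, and the pending mass of the slot is
`≤ (B₀·D∕η)·(z⁻¹)^Ah` with `D = 1∕(1 − z₁⁻¹z)`: the renewal route's per-slot bound with NO relative price of anybody's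
weights left as a hypothesis — what remains is the catalogue `hcat`, the root mass, the slack and the ledger.
§4 a decided two-node toy (the dictionary's sanity slot: root `{born 0 0}`, one birth edge at step 1) with every
hypothesis discharged at once.

HONEST DEPENDENCY (cell): continuum YM on T⁴ ⇐ BetaPertH ∧ nine spine estimates (0/9 proved); BetaPertH ⇐ (D1) ∧ (D4)
∧ CAP+tail.  This file changes none of it.
-/

open Finset
open Literature.MathematicalPhysics.QuantumFieldTheory.Balaban1983to89
open T4PersistenceDictionary T4PersistenceRenewal T4PersistenceGrove

namespace Summit.QuantumFields.BalabanUV.T4Continuum.RenewalGroveSum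

noncomputable section

/-! ## §1 The banked constructor with a combined per-parent catalogue -/

section Banked

variable {ι : Type*} [DecidableEq ι]

/-- **BANKED PRICING, COMBINED CATALOGUE ⇒ PER-FIBRE EVENT DOMINATION.**  As
`T4PersistenceRenewal.ForestDom.of_banked_pricing` (forest `Φ`, weight majorant `ω ≥ 0`, effective remaining horizon `E`,
root profile `b` with budget `b s·z^s ≤ B₀·a₀`, run tilt `1 ≤ z < z₁`, slack `ε·(z∕z₁)∕(1 − z∕z₁) ≤ 1 − η`, pending
class alive across the horizon with weights under the majorant) EXCEPT that the children are controlled by ONE per-parent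
banked sum: for every component `P` and every later age `s`,
`Σ_{c : last c = s, c ∉ roots, parent c = P} ω c·z₁^(E c)·z₁^(s − last P) ≤ ε·(ω P·z₁^(E P))`.
Conclusion `ForestDom Pend w a₀ Ah z η B₀ (1∕(1 − z₁⁻¹·z))`. [folklore] -/
theorem forestDom_of_banked_sum {Pend : Finset ι} {w : ι → ℝ} {a₀ : ℝ} {Ah : ℕ}
    {z z₁ η B₀ ε : ℝ} (Φ : EventForest ι) (ω : ι → ℝ) (E : ι → ℕ) (b : ℕ → ℝ)
    (hz : 1 ≤ z) (hzz : z < z₁) (hε : 0 ≤ ε)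
    (pend_sub : Pend ⊆ Φ.Cmp) (last_le : ∀ c ∈ Pend, Φ.last c ≤ Ah) (ω_nonneg : ∀ c ∈ Φ.Cmp, 0 ≤ ω c)
    (hslack : ε * ((z / z₁) / (1 - z / z₁)) ≤ 1 - η)
    (root_budget : ∀ s, b s * z ^ s ≤ B₀ * a₀)
    (root : ∀ s, ∑ c ∈ Φ.Cmp with (Φ.last c = s ∧ c ∈ Φ.roots), ω c * z₁ ^ (E c) ≤ b s)
    (hsum : ∀ P ∈ Φ.Cmp, ∀ s, Φ.last P < s →
      ∑ c ∈ Φ.Cmp with (Φ.last c = s ∧ c ∉ Φ.roots ∧ Φ.parent c = P),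
        ω c * z₁ ^ (E c) * z₁ ^ (s - Φ.last P) ≤ ε * (ω P * z₁ ^ (E P)))
    (alive : ∀ c ∈ Pend, Ah - Φ.last c ≤ E c) (weight_le : ∀ c ∈ Pend, w c ≤ ω c) :
    ForestDom Pend w a₀ Ah z η B₀ (1 / (1 - z₁⁻¹ * z)) := by
  have hz0 : 0 < z := lt_of_lt_of_le one_pos hz
  have hz₁0 : 0 < z₁ := hz0.trans hzz
  have hz₁1 : 1 ≤ z₁ := hz.trans hzz.le
  have hσ : 0 ≤ z₁⁻¹ := inv_nonneg.2 hz₁0.le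
  -- the banked potential
  let v : ι → ℝ := fun c => ω c * z₁ ^ (E c)
  have v_nonneg : ∀ c ∈ Φ.Cmp, 0 ≤ v c := fun c hc => mul_nonneg (ω_nonneg c hc) (pow_nonneg hz₁0.le _)
  have child : ∀ P ∈ Φ.Cmp, ∀ s, Φ.last P < s →
      ∑ c ∈ Φ.Cmp with (Φ.last c = s ∧ c ∉ Φ.roots ∧ Φ.parent c = P), v c ≤ ε * z₁⁻¹ ^ (s - Φ.last P) * v P := by
    intro P hP s hs
    have hpow : 0 < z₁ ^ (s - Φ.last P) := pow_pos hz₁0 _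
    have h := hsum P hP s hs
    have h' : (∑ c ∈ Φ.Cmp with (Φ.last c = s ∧ c ∉ Φ.roots ∧ Φ.parent c = P), v c) * z₁ ^ (s - Φ.last P) ≤
        ε * v P := by
      rw [Finset.sum_mul]; exact h
    rw [← le_div_iff₀ hpow] at h'
    refine h'.trans (le_of_eq ?_)
    rw [inv_pow, div_eq_mul_inv]; ring
  let X : ForestWitness Pend w a₀ Ah z η B₀ :=
    { forest := Φ
      v := v
      F := fun _ ℓ => ε * z₁⁻¹ ^ ℓ
      b := b
      term := fun s => z₁⁻¹ ^ (Ah - s)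
      pend_sub := pend_sub
      last_le := last_le
      v_nonneg := v_nonneg
      F_nonneg := fun _ ℓ => mul_nonneg hε (pow_nonneg hσ _)
      gen := fun s => (banked_column_le_geom hz0.le hz₁0 hzz hε s).trans hslack
      root_budget := root_budget
      root := root
      child := child
      term_nonneg := fun s => pow_nonneg hσ _
      weight_le := by
        intro c hc
        show w c ≤ z₁⁻¹ ^ (Ah - Φ.last c) * (ω c * z₁ ^ (E c))
        obtain ⟨d, hd⟩ := Nat.exists_eq_add_of_le (alive c hc)
        have hω := ω_nonneg c (pend_sub hc)
        have hsplit : z₁⁻¹ ^ (Ah - Φ.last c) * (ω c * z₁ ^ (E c)) = ω c * z₁ ^ d := by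
          rw [hd, pow_add, inv_pow]
          field_simp
        rw [hsplit]
        exact (weight_le c hc).trans (le_mul_of_one_le_right hω (one_le_pow₀ hz₁1)) }
  have hσz : z₁⁻¹ * z < 1 := by
    rw [inv_mul_lt_iff₀ hz₁0]; simpa using hzz
  exact X.dom_of_pairing (W := fun s => Ah - s) hσ hz hσz fun s _ => by
    show z₁⁻¹ ^ (Ah - s) ≤ if Ah - s ≤ Ah - s then z₁⁻¹ ^ (Ah - s) else 0
    rw [if_pos le_rfl]

end Banked

/-! ## §2 The ledger form: raw prices + a combined per-parent catalogue of own bookings -/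

section Ledger

variable {ι : Type*} [DecidableEq ι] {ε : Type*}

/-- **THE COMBINED-CATALOGUE LEDGER CONSTRUCTOR.**  As `T4PersistenceGrove.forestDom_of_grove_raw` — LEDGER: `hroot` (a
root is the bare birth `{born (ev c) j}` followed by its determined tail), `hstep` (every other component arises from its
parent by the script headed by the undone event at step `j + last c`), `hpend` (a pending history's grove reaches beyond
`j + Ah`); RAW PRICES: `hraw₀ : ω c ≤ pr c·a₀` on roots, `hraw : ω c ≤ pr c·ω (parent c)` otherwise; ROOT MASS
`Σ_roots pr c·z₁^(booking c) ≤ B₀`; SLACK — EXCEPT that the split catalogue ((SH), `φ`, `Shapes`, (ENT)) is replaced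
by ONE PER-PARENT, PARENT-UNIFORM CLAUSE at ages within the horizon:
`hcat : Σ_{c : last c = s, c ∉ roots, parent c = P} pr c·z₁^(booking c) ≤ εc` (`s ≤ Ah`).
Conclusion `ForestDom Pend w a₀ Ah z η B₀ (1∕(1 − z₁⁻¹·z))`. [folklore] -/
theorem forestDom_of_grove_sum {Pend : Finset ι} {w : ι → ℝ} {a₀ : ℝ} {Ah : ℕ}
    {z z₁ η B₀ εc : ℝ} (Φ : EventForest ι) (ω pr : ι → ℝ)
    (W : ε → ℕ) (j : ℕ) (grove : ι → Grove ε) (ev : ι → ε) (tail : ι → List (ε × ℕ))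
    (hz : 1 ≤ z) (hzz : z < z₁) (hε : 0 ≤ εc) (ha₀ : 0 ≤ a₀) (hB₀ : 0 ≤ B₀)
    (pend_sub : Pend ⊆ Φ.Cmp) (hCmp : ∀ c ∈ Φ.Cmp, Φ.last c ≤ Ah) (ω_nonneg : ∀ c ∈ Φ.Cmp, 0 ≤ ω c)
    (hslack : εc * ((z / z₁) / (1 - z / z₁)) ≤ 1 - η)
    -- LEDGER, roots: bare birth at the slot step, age 0, then the determined tail
    (hroot : ∀ c ∈ Φ.Cmp, c ∈ Φ.roots →
      Φ.last c = 0 ∧ Script W ({Gen.born (ev c) j} : Grove ε) (tail c) (grove c))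
    -- raw root price relative to the reference weight, and the root pairing mass
    (hraw₀ : ∀ c ∈ Φ.Cmp, c ∈ Φ.roots → ω c ≤ pr c * a₀)
    (hpair₀ : ∑ c ∈ Φ.Cmp with c ∈ Φ.roots, pr c * z₁ ^ (booking W ev tail c) ≤ B₀)
    -- LEDGER, edges: one scripted ledger move headed by the undone event
    (hstep : ∀ c ∈ Φ.Cmp, c ∉ Φ.roots → Script W (grove (Φ.parent c)) ((ev c, j + Φ.last c) :: tail c) (grove c))
    -- raw conditional price of one more event
    (hraw : ∀ c ∈ Φ.Cmp, c ∉ Φ.roots → ω c ≤ pr c * ω (Φ.parent c))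
    -- THE COMBINED CATALOGUE: per parent and age within the horizon, the children's prices paired against their OWN
    -- bookings sum to at most `εc`, uniformly in the parent
    (hcat : ∀ P ∈ Φ.Cmp, ∀ s, s ≤ Ah → Φ.last P < s →
      ∑ c ∈ Φ.Cmp with (Φ.last c = s ∧ c ∉ Φ.roots ∧ Φ.parent c = P), pr c * z₁ ^ (booking W ev tail c) ≤ εc)
    (hpend : ∀ c ∈ Pend, j + Ah < mreach W (grove c)) (weight_le : ∀ c ∈ Pend, w c ≤ ω c) :
    ForestDom Pend w a₀ Ah z η B₀ (1 / (1 - z₁⁻¹ * z)) := by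
  have hz₁ : 1 ≤ z₁ := hz.trans hzz.le
  have hz₁0 : 0 < z₁ := lt_of_lt_of_le one_pos hz₁
  -- the root profile: everything at age 0
  let b : ℕ → ℝ := fun s => if s = 0 then B₀ * a₀ else 0
  refine forestDom_of_banked_sum Φ ω (horizon W j Φ grove) b hz hzz hε pend_sub
    (fun c hc => hCmp c (pend_sub hc)) ω_nonneg hslack ?_ ?_ ?_ (fun c hc => horizon_alive (hpend c hc)) weight_le
  · -- root budget
    intro s
    by_cases hs : s = 0
    · subst hs; simp [b]
    · simp only [b, if_neg hs, zero_mul]; exact mul_nonneg hB₀ ha₀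
  · -- banked root bound from the raw root price and the root pairing mass
    intro s
    by_cases hs : s = 0
    · subst hs
      simp only [b, if_pos rfl]
      have hfilter : (Φ.Cmp.filter fun c => Φ.last c = 0 ∧ c ∈ Φ.roots) = Φ.Cmp.filter fun c => c ∈ Φ.roots := by
        refine Finset.filter_congr fun c hc => ⟨fun h => h.2, fun h => ⟨(hroot c hc h).1, h⟩⟩
      rw [hfilter]
      calc ∑ c ∈ Φ.Cmp with c ∈ Φ.roots, ω c * z₁ ^ (horizon W j Φ grove c)
          ≤ ∑ c ∈ Φ.Cmp with c ∈ Φ.roots, pr c * z₁ ^ (booking W ev tail c) * a₀ := by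
            refine Finset.sum_le_sum fun c hc => ?_
            obtain ⟨hcC, hcr⟩ := Finset.mem_filter.1 hc
            obtain ⟨hl0, hscr⟩ := hroot c hcC hcr
            refine banked_root_of_raw hz₁ (ω_nonneg c hcC) (hraw₀ c hcC hcr) ?_
            have h := hscr.root_horizon_le
            simp only [horizon, booking, hl0, Nat.add_zero]
            exact h
        _ = (∑ c ∈ Φ.Cmp with c ∈ Φ.roots, pr c * z₁ ^ (booking W ev tail c)) * a₀ := by
            rw [Finset.sum_mul]
        _ ≤ B₀ * a₀ := mul_le_mul_of_nonneg_right hpair₀ ha₀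
    · simp only [b, if_neg hs]
      have hempty : (Φ.Cmp.filter fun c => Φ.last c = s ∧ c ∈ Φ.roots) = ∅ := by
        refine Finset.filter_eq_empty_iff.2 fun c hc h => hs ?_
        rw [← h.1, (hroot c hc h.2).1]
      rw [hempty, Finset.sum_empty]
  · -- the banked per-parent sum from the raw prices, the own bookings and the ledger increments
    intro P hP s hs
    have hvP : 0 ≤ ω P * z₁ ^ (horizon W j Φ grove P) := mul_nonneg (ω_nonneg P hP) (pow_nonneg hz₁0.le _)
    by_cases hsA : s ≤ Ah
    · calc ∑ c ∈ Φ.Cmp with (Φ.last c = s ∧ c ∉ Φ.roots ∧ Φ.parent c = P),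
              ω c * z₁ ^ (horizon W j Φ grove c) * z₁ ^ (s - Φ.last P)
            ≤ ∑ c ∈ Φ.Cmp with (Φ.last c = s ∧ c ∉ Φ.roots ∧ Φ.parent c = P),
              pr c * z₁ ^ (booking W ev tail c) * (ω P * z₁ ^ (horizon W j Φ grove P)) := by
              refine Finset.sum_le_sum fun c hc => ?_
              obtain ⟨hcC, hls, hr, hpar⟩ := Finset.mem_filter.1 hc
              have hinc := horizon_increment (W := W) (j := j) (grove := grove) (ev := ev) (tail := tail)
                hcC hr (hstep c hcC hr)
              rw [hpar, hls] at hinc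
              have h := banked_price_of_increment hz₁ (ω_nonneg c hcC) (ω_nonneg P hP)
                (by simpa [hpar] using hraw c hcC hr) (le_refl (pr c * z₁ ^ (booking W ev tail c))) hinc
              exact h
          _ = (∑ c ∈ Φ.Cmp with (Φ.last c = s ∧ c ∉ Φ.roots ∧ Φ.parent c = P),
              pr c * z₁ ^ (booking W ev tail c)) * (ω P * z₁ ^ (horizon W j Φ grove P)) := by
              rw [Finset.sum_mul]
          _ ≤ εc * (ω P * z₁ ^ (horizon W j Φ grove P)) :=
              mul_le_mul_of_nonneg_right (hcat P hP s hsA hs) hvP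
    · -- beyond the horizon there are no components at all
      have hempty : (Φ.Cmp.filter fun c => Φ.last c = s ∧ c ∉ Φ.roots ∧ Φ.parent c = P) = ∅ := by
        refine Finset.filter_eq_empty_iff.2 fun c hc h => hsA ?_
        rw [← h.1]; exact hCmp c hc
      rw [hempty, Finset.sum_empty]
      exact mul_nonneg hε hvP

end Ledger

/-! ## §3 The absolute-majorant form: a product weight has its raw prices by `le_of_eq` -/

section Product

variable {ι : Type*} [DecidableEq ι] {ε : Type*}

/-- **THE PRODUCT MAJORANT NEEDS NO RELATIVE PRICE.**  If the weight of a record IS the product of its edge prices along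
the forest — `ω c = pr c` on roots, `ω c = pr c·ω (parent c)` otherwise, `pr ≥ 0` — then `forestDom_of_grove_sum` applies
with reference weight `a₀ = 1`, actual weights `w := ω`, and BOTH raw price clauses discharged by `le_of_eq`: what is
asked is only the ledger (`hroot`, `hstep`, `hpend`), the root mass, the combined catalogue and the slack.
Conclusion `ForestDom Pend ω 1 Ah z η B₀ (1∕(1 − z₁⁻¹·z))`. [folklore] -/
theorem forestDom_of_grove_product {Pend : Finset ι} {Ah : ℕ}
    {z z₁ η B₀ εc : ℝ} (Φ : EventForest ι) (ω pr : ι → ℝ)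
    (W : ε → ℕ) (j : ℕ) (grove : ι → Grove ε) (ev : ι → ε) (tail : ι → List (ε × ℕ))
    (hz : 1 ≤ z) (hzz : z < z₁) (hε : 0 ≤ εc) (hB₀ : 0 ≤ B₀)
    (pend_sub : Pend ⊆ Φ.Cmp) (hCmp : ∀ c ∈ Φ.Cmp, Φ.last c ≤ Ah) (ω_nonneg : ∀ c ∈ Φ.Cmp, 0 ≤ ω c)
    (hslack : εc * ((z / z₁) / (1 - z / z₁)) ≤ 1 - η)
    (hroot : ∀ c ∈ Φ.Cmp, c ∈ Φ.roots →
      Φ.last c = 0 ∧ Script W ({Gen.born (ev c) j} : Grove ε) (tail c) (grove c))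
    -- the weight is the product of the edge prices
    (hωroot : ∀ c ∈ Φ.Cmp, c ∈ Φ.roots → ω c = pr c)
    (hωstep : ∀ c ∈ Φ.Cmp, c ∉ Φ.roots → ω c = pr c * ω (Φ.parent c))
    (hpair₀ : ∑ c ∈ Φ.Cmp with c ∈ Φ.roots, pr c * z₁ ^ (booking W ev tail c) ≤ B₀)
    (hstep : ∀ c ∈ Φ.Cmp, c ∉ Φ.roots → Script W (grove (Φ.parent c)) ((ev c, j + Φ.last c) :: tail c) (grove c))
    (hcat : ∀ P ∈ Φ.Cmp, ∀ s, s ≤ Ah → Φ.last P < s →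
      ∑ c ∈ Φ.Cmp with (Φ.last c = s ∧ c ∉ Φ.roots ∧ Φ.parent c = P), pr c * z₁ ^ (booking W ev tail c) ≤ εc)
    (hpend : ∀ c ∈ Pend, j + Ah < mreach W (grove c)) :
    ForestDom Pend ω 1 Ah z η B₀ (1 / (1 - z₁⁻¹ * z)) :=
  forestDom_of_grove_sum Φ ω pr W j grove ev tail hz hzz hε zero_le_one hB₀ pend_sub hCmp ω_nonneg hslack hroot
    (fun c hc hr => by rw [hωroot c hc hr, mul_one]) hpair₀ hstep (fun c hc hr => (hωstep c hc hr).le) hcat hpend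
    (fun _ _ => le_rfl)

/-- **THE PER-SLOT BOUND OF THE RENEWAL ROUTE IN ABSOLUTE CURRENCY**: under the hypotheses of
`forestDom_of_grove_product` with `0 < η`, the pending product-majorant mass of the slot is
`Σ_{c ∈ Pend} ω c ≤ (B₀·(1∕(1 − z₁⁻¹z))∕η)·(z⁻¹)^Ah` — age decay at the run tilt, constants free of the horizon
(`ForestDom.sum_le` with reference weight `1`). [folklore] -/
theorem sum_le_of_grove_product {Pend : Finset ι} {Ah : ℕ}
    {z z₁ η B₀ εc : ℝ} (Φ : EventForest ι) (ω pr : ι → ℝ)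
    (W : ε → ℕ) (j : ℕ) (grove : ι → Grove ε) (ev : ι → ε) (tail : ι → List (ε × ℕ))
    (hz : 1 ≤ z) (hzz : z < z₁) (hε : 0 ≤ εc) (hη : 0 < η) (hB₀ : 0 ≤ B₀)
    (pend_sub : Pend ⊆ Φ.Cmp) (hCmp : ∀ c ∈ Φ.Cmp, Φ.last c ≤ Ah) (ω_nonneg : ∀ c ∈ Φ.Cmp, 0 ≤ ω c)
    (hslack : εc * ((z / z₁) / (1 - z / z₁)) ≤ 1 - η)
    (hroot : ∀ c ∈ Φ.Cmp, c ∈ Φ.roots →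
      Φ.last c = 0 ∧ Script W ({Gen.born (ev c) j} : Grove ε) (tail c) (grove c))
    (hωroot : ∀ c ∈ Φ.Cmp, c ∈ Φ.roots → ω c = pr c)
    (hωstep : ∀ c ∈ Φ.Cmp, c ∉ Φ.roots → ω c = pr c * ω (Φ.parent c))
    (hpair₀ : ∑ c ∈ Φ.Cmp with c ∈ Φ.roots, pr c * z₁ ^ (booking W ev tail c) ≤ B₀)
    (hstep : ∀ c ∈ Φ.Cmp, c ∉ Φ.roots → Script W (grove (Φ.parent c)) ((ev c, j + Φ.last c) :: tail c) (grove c))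
    (hcat : ∀ P ∈ Φ.Cmp, ∀ s, s ≤ Ah → Φ.last P < s →
      ∑ c ∈ Φ.Cmp with (Φ.last c = s ∧ c ∉ Φ.roots ∧ Φ.parent c = P), pr c * z₁ ^ (booking W ev tail c) ≤ εc)
    (hpend : ∀ c ∈ Pend, j + Ah < mreach W (grove c)) :
    ∑ c ∈ Pend, ω c ≤ B₀ * (1 / (1 - z₁⁻¹ * z)) / η * (z⁻¹) ^ Ah * 1 :=
  (forestDom_of_grove_product Φ ω pr W j grove ev tail hz hzz hε hB₀ pend_sub hCmp ω_nonneg hslack hroot hωroot hωstep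
    hpair₀ hstep hcat hpend).sum_le (lt_of_lt_of_le one_pos hz) hη hB₀ zero_le_one

end Product

/-! ## §4 A decided toy: the dictionary's sanity slot, root `{born 0 0}` and ONE birth edge at step `1` -/

section Toy

open Gen

/-- **EVERY HYPOTHESIS AT ONCE** on the lineage's sanity slot (`T4PersistenceGrove` §4): components `Bool` — `false` =
the root (bare birth of region `0` at step `j = 0`, grove `g₀ = {born 0 0}`), `true` = the root followed by the birth of
constituent `1` at age `1` (grove `g₁ = born 1 1 ::ₘ g₀`, the ledger step `step₁`), truncation `true ↦ false`; prices
`1∕64` (root) and `1∕1024` (edge), PRODUCT weight; windows `W₀ = (3, 4, 2)`, horizon `Ah = 4` (the child's grove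
reaches `5 > 0 + 4`), tilts `z = 2 < z₁ = 4`, catalogue mass `εc = 1∕4` (the one child books its own window `4`:
`(1∕1024)·4⁴ = 1∕4`), slack `(1∕4)·((2∕4)∕(1 − 2∕4)) = 1∕4 ≤ 1 − 3∕4`, root mass `(1∕64)·4³ = 1 = B₀`:
`ForestDom {true} ω 1 4 2 (3∕4) 1 (1∕(1 − 4⁻¹·2))`. [folklore] -/
theorem forestDom_toy : ForestDom ({true} : Finset Bool) (fun c => if c then 1 / 1024 * (1 / 64) else 1 / 64)
    1 4 2 (3 / 4) 1 (1 / (1 - (4 : ℝ)⁻¹ * 2)) := by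
  -- the forest, groves, undone events and edge prices of the toy
  let Φ : EventForest Bool :=
    { Cmp := univ
      roots := {false}
      last := fun c => if c then 1 else 0
      parent := fun _ => false
      parent_mem := fun _ _ _ => mem_univ _
      last_lt := fun c _ hr => by
        cases c
        · exact absurd (mem_singleton_self false) hr
        · simp }
  let grove : Bool → Grove ℕ := fun c => if c then g₁ else g₀
  let ev : Bool → ℕ := fun c => if c then 1 else 0
  let pr : Bool → ℝ := fun c => if c then 1 / 1024 else 1 / 64
  have hCmp : ∀ c, c ∈ Φ.Cmp := fun c => mem_univ c
  have hroots : ∀ c, c ∈ Φ.roots ↔ c = false := fun c => by simp [Φ]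
  refine forestDom_of_grove_product (εc := 1 / 4) Φ _ pr W₀ 0 grove ev (fun _ => [])
    (by norm_num) (by norm_num) (by norm_num) (by norm_num) (fun c _ => hCmp c) ?_ ?_ (by norm_num) ?_ ?_ ?_ ?_ ?_ ?_ ?_
  · -- ages ≤ 4
    intro c _; cases c <;> simp [Φ]
  · intro c _; cases c <;> norm_num
  · -- roots: the bare birth, no tail
    intro c _ hr
    rw [hroots] at hr
    subst hr
    exact ⟨rfl, by simpa [ev, grove, g₀] using Script.nil ({Gen.born 0 0} : Grove ℕ)⟩
  · intro c _ hr
    rw [hroots] at hr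
    subst hr; rfl
  · intro c _ hr
    rw [hroots] at hr
    cases c
    · exact absurd rfl hr
    · simp [pr, Φ]
  · -- root pairing mass: `(1/64)·4^3 = 1`
    have hf : (Φ.Cmp.filter fun c => c ∈ Φ.roots) = {false} := by
      ext c; cases c <;> simp [Φ]
    rw [hf, sum_singleton]
    simp [pr, booking, ev, W₀]
    norm_num
  · -- the one edge is the ledger's birth step `step₁ : Step W₀ g₀ 1 1 g₁`
    intro c _ hr
    rw [hroots] at hr
    cases c
    · exact absurd rfl hr
    · simpa [Φ, grove, ev] using Script.single step₁
  · -- the combined catalogue: only the parent `false` at age `1` has a child, which books `W₀ 1 = 4`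
    intro P _ s _ _
    have hsub : (Φ.Cmp.filter fun c => Φ.last c = s ∧ c ∉ Φ.roots ∧ Φ.parent c = P) ⊆ {true} := by
      intro c hc
      cases c
      · simp [Φ] at hc
      · exact mem_singleton_self _
    calc ∑ c ∈ Φ.Cmp with (Φ.last c = s ∧ c ∉ Φ.roots ∧ Φ.parent c = P), pr c * (4 : ℝ) ^ (booking W₀ ev (fun _ => []) c)
        ≤ ∑ c ∈ ({true} : Finset Bool), pr c * (4 : ℝ) ^ (booking W₀ ev (fun _ => []) c) :=
          sum_le_sum_of_subset_of_nonneg hsub fun c _ _ => by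
            cases c <;> simp [pr]
      _ ≤ 1 / 4 := by simp [pr, booking, ev, W₀]; norm_num
  · -- pending: the child's grove reaches `5 > 0 + 4`
    intro c hc
    rw [mem_singleton] at hc
    subst hc
    simp [grove, g₁, W₀]

/-- … hence the pending mass `1∕65536 ≤ (1·2∕(3∕4))·(1∕2)^4·1 = 1∕6` by `ForestDom.sum_le` — consistent. -/
example : ∑ c ∈ ({true} : Finset Bool), (fun c : Bool => if c then (1 : ℝ) / 1024 * (1 / 64) else 1 / 64) c ≤
    1 * (1 / (1 - (4 : ℝ)⁻¹ * 2)) / (3 / 4) * ((2 : ℝ)⁻¹) ^ 4 * 1 :=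
  forestDom_toy.sum_le (by norm_num) (by norm_num) (by norm_num) zero_le_one

/-- the numbers of the toy, decided: pending mass, the bound, catalogue mass, slack, root mass -/
example : (1 : ℚ) / 1024 * (1 / 64) = 1 / 65536 ∧ (1 : ℚ) * (1 / (1 - 1 / 4 * 2)) / (3 / 4) * (1 / 2) ^ 4 = 1 / 6 ∧
    (1 : ℚ) / 1024 * 4 ^ 4 = 1 / 4 ∧ (1 : ℚ) / 4 * ((2 / 4) / (1 - 2 / 4)) = 1 - 3 / 4 ∧ (1 : ℚ) / 64 * 4 ^ 3 = 1 := by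
  norm_num

end Toy

end

end Summit.QuantumFields.BalabanUV.T4Continuum.RenewalGroveSum
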